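import Summits.FinalStateConjecture.FinalStateConjecture.Theorems.SwallowTheDatumParametricKerrBurialEngine
import Summits.FinalStateConjecture.FinalStateConjecture.Theorems.SwallowTheDatumParametricKerrBurialStubEndRescaling
import Mathlib.Analysis.Calculus.ContDiff.Bounds
import Mathlib.Analysis.Calculus.MeanValue
import Mathlib.Analysis.InnerProductSpace.Calculus
import HarnessLib

/-!
# Stub `stub_siteReadingDev` of the line `Sketch` (crux `SwallowTheDatum.UniversalWitnessFamily`,
# item stmt-FinalStateConjecture-10051) — toolkit T3 of `stub_bulkAt`: the site reading deviation

Each puncture `c` of the Brill–Lindquist bulk `B` (time-symmetric, conformal factor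
`ψ = b + α/‖y − c‖ + w(y)` near `c`, `w` = the variation of the regular part, `w(c) = 0`) is a Thm-1.7
gluing site, read by the PURE PULL-BACK `ẑ ↦ c + s ẑ` at the pinned scale `s = b⁻²`.  On the unit-chart
annulus `16 ≤ ‖ẑ‖ ≤ 128` the reading `s² h_B(c + s ẑ)` must be `C²`-close to the exact Schwarzschild far
field `schwField (2αb) = (1 + αb/‖ẑ‖)⁴ • δ`; this file proves that closeness, linearly in the `C¹/C²` size
`W` of `w` at the site scale (`‖D^m w‖ ≤ W b^{2m+1}` on `B(c, 256/b²)`, `m = 1, 2`), with ONE absolute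
constant `K`:

* §1 pointwise `C²` calculus on `ℝ³` (sums, products, constants: Leibniz bounds at a point of an open set
  of smoothness) and an absolute bound for `D^j (‖·‖⁻¹)`, `j ≤ 2`, on the compact annulus (continuity; no
  derivative is computed);
* §2 the scaled variation `ŵ(ẑ) = w(c + s ẑ)/b`: `‖D^j ŵ‖ ≤ W` (`j = 1, 2`; the scaling
  `‖D^m (F ∘ (s ·))(x)‖ ≤ s^m ‖D^m F(s x)‖` of `…ParametricKerrBurialStubEndRescaling`, and `s^j b^{2j} = 1`)
  and `|ŵ(ẑ)| ≤ 128 W` (mean value inequality from `ŵ(0) = 0`);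
* §3 the identity `s² h_B(c + s ẑ) − schwField(2αb) ẑ = ((u + ŵ)⁴ − u⁴) • δ`, `u = 1 + αb/‖ẑ‖`,
  `(u + ŵ)⁴ − u⁴ = ŵ (2u + ŵ)((u + ŵ)² + u²)`, on the punctured ball `0 < ‖ẑ‖ < 256` (an open
  neighbourhood of the annulus, so that `iteratedFDeriv` is local), and the assembly.

References: Mao–Oh–Tao arXiv:2308.13031 Thm 1.7, Rem 1.11; Brill–Lindquist, Phys. Rev. 131 (1963) 471.
-/

-- `Summit.<Summit>.<Problem>` is the tree's mandated summit-side namespace (CONVENTIONS §2); for this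
-- single-conjunct summit the two coincide, so the duplicate is deliberate.
set_option linter.dupNamespace false

noncomputable section

-- instance search through the nested operator types `E3 →L E3 →L ℝ`
set_option maxSynthPendingDepth 3

namespace Summit.FinalStateConjecture.FinalStateConjecture.Theorems.SwallowTheDatum.UniversalWitnessFamily

open scoped Manifold ContDiff Topology BigOperators InnerProductSpace
open Set Filter Function Literature.Geometry.Lorentzian Literature.Geometry.Lorentzian.InitialDataSet
open Summit.FinalStateConjecture.FinalStateConjecture.Theorems.SwallowTheDatum.ParametricKerrBurial (schwField
  norm_iteratedFDeriv_comp_smul_le)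

/-! ## §1 Pointwise `C²` calculus on `ℝ³` -/

/-- `C²` size of a constant: `‖D^j (const a)(x)‖ ≤ |a|` for `j ≤ 2`. [folklore] -/
theorem srd_c2_const (a : ℝ) (x : E3) : ∀ j ≤ 2, ‖iteratedFDeriv ℝ j (fun _ : E3 ↦ a) x‖ ≤ |a| := by
  intro j _
  rcases Nat.eq_zero_or_pos j with rfl | hj0
  · rw [norm_iteratedFDeriv_zero, Real.norm_eq_abs]
  · rw [iteratedFDeriv_const_of_ne hj0.ne' a, Pi.zero_apply, norm_zero]
    exact abs_nonneg a

/-- `C²` size of a sum at a point of an open set of smoothness. [folklore] -/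
theorem srd_c2_add {U : Set E3} (hU : IsOpen U) {x : E3} (hx : x ∈ U) {f g : E3 → ℝ} {A B : ℝ}
    (hf : ContDiffOn ℝ ∞ f U) (hg : ContDiffOn ℝ ∞ g U)
    (hA : ∀ j ≤ 2, ‖iteratedFDeriv ℝ j f x‖ ≤ A) (hB : ∀ j ≤ 2, ‖iteratedFDeriv ℝ j g x‖ ≤ B) :
    ∀ j ≤ 2, ‖iteratedFDeriv ℝ j (fun z ↦ f z + g z) x‖ ≤ A + B := by
  intro j hj
  have hfx : ContDiffAt ℝ (j : WithTop ℕ∞) f x :=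
    (hf.contDiffAt (hU.mem_nhds hx)).of_le (by exact_mod_cast le_top)
  have hgx : ContDiffAt ℝ (j : WithTop ℕ∞) g x :=
    (hg.contDiffAt (hU.mem_nhds hx)).of_le (by exact_mod_cast le_top)
  rw [fun_iteratedFDeriv_add_apply hfx hgx]
  exact (norm_add_le _ _).trans (add_le_add (hA j hj) (hB j hj))

/-- **Leibniz bound at a point** (`Σ_i C(j, i) = 2^j ≤ 4`): `C²` size of a product at a point of an open
set of smoothness. [folklore] -/
theorem srd_c2_mul {U : Set E3} (hU : IsOpen U) {x : E3} (hx : x ∈ U) {f g : E3 → ℝ} {A B : ℝ}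
    (hf : ContDiffOn ℝ ∞ f U) (hg : ContDiffOn ℝ ∞ g U)
    (hA : ∀ j ≤ 2, ‖iteratedFDeriv ℝ j f x‖ ≤ A) (hB : ∀ j ≤ 2, ‖iteratedFDeriv ℝ j g x‖ ≤ B) :
    ∀ j ≤ 2, ‖iteratedFDeriv ℝ j (fun z ↦ f z * g z) x‖ ≤ 4 * A * B := by
  -- adapted from `norm_iteratedFDeriv_mul_le_of_le` (Literature/Analysis/Distribution/ExpLinearEstimates.lean)
  intro j hj
  have h0A : 0 ≤ A := (norm_nonneg _).trans (hA 0 (Nat.zero_le _))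
  have hloc : ∀ (n : ℕ) (φ : E3 → ℝ), iteratedFDerivWithin ℝ n φ U x = iteratedFDeriv ℝ n φ x :=
    fun n φ ↦ iteratedFDerivWithin_of_isOpen n hU hx
  have h := norm_iteratedFDerivWithin_mul_le (n := j) hf hg hU.uniqueDiffOn hx
    (by exact_mod_cast le_top)
  simp only [hloc] at h
  refine h.trans ?_
  calc ∑ i ∈ Finset.range (j + 1),
        (j.choose i : ℝ) * ‖iteratedFDeriv ℝ i f x‖ * ‖iteratedFDeriv ℝ (j - i) g x‖
      ≤ ∑ i ∈ Finset.range (j + 1), (j.choose i : ℝ) * A * B := by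
        refine Finset.sum_le_sum fun i hi ↦ ?_
        have hi' : i ≤ j := Nat.lt_succ_iff.1 (Finset.mem_range.1 hi)
        have h1 := hA i (hi'.trans hj)
        have h2 := hB (j - i) ((Nat.sub_le _ _).trans hj)
        exact mul_le_mul (mul_le_mul_of_nonneg_left h1 (by positivity)) h2 (norm_nonneg _)
          (mul_nonneg (by positivity) h0A)
    _ = 2 ^ j * A * B := by
        rw [← Finset.sum_mul, ← Finset.sum_mul]
        congr 2
        exact_mod_cast Nat.sum_range_choose j
    _ ≤ 4 * A * B := by
        have h2j : (2 : ℝ) ^ j ≤ 4 := by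
          calc (2 : ℝ) ^ j ≤ 2 ^ 2 := pow_le_pow_right₀ (by norm_num) hj
            _ = 4 := by norm_num
        have h0B : 0 ≤ B := (norm_nonneg _).trans (hB 0 (Nat.zero_le _))
        have := mul_le_mul_of_nonneg_right h2j (mul_nonneg h0A h0B)
        nlinarith

/-- Each `D^j (‖·‖⁻¹)` is bounded on the compact annulus `{16 ≤ ‖x‖ ≤ 128}` (continuity of the iterated
derivative of a function smooth on the open set `{1 < ‖y‖}`). [folklore] -/
theorem srd_exists_bound_invNorm_j (j : ℕ) :
    ∃ B : ℝ, 0 ≤ B ∧ ∀ x : E3, 16 ≤ ‖x‖ → ‖x‖ ≤ 128 →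
      ‖iteratedFDeriv ℝ j (fun y : E3 ↦ ‖y‖⁻¹) x‖ ≤ B := by
  -- adapted from `exists_bound_Fk` (…UniversalWitnessFamilyStubSchwOutSiteAux1.lean)
  set F : E3 → ℝ := fun y ↦ ‖y‖⁻¹ with hF_def
  set U : Set E3 := {y | 1 < ‖y‖} with hU_def
  have hU : IsOpen U := isOpen_lt continuous_const continuous_norm
  have hcd : ContDiffOn ℝ (j : ℕ∞) F U := fun y hy ↦ by
    have hy0 : y ≠ 0 := norm_pos_iff.1 (lt_trans one_pos hy)
    exact ((contDiffAt_norm ℝ hy0).inv (norm_ne_zero_iff.2 hy0)).contDiffWithinAt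
  have hc1 : ContinuousOn (iteratedFDerivWithin ℝ j F U) U :=
    hcd.continuousOn_iteratedFDerivWithin le_rfl hU.uniqueDiffOn
  have hc2 : ContinuousOn (iteratedFDeriv ℝ j F) U :=
    hc1.congr fun y hy ↦ (iteratedFDerivWithin_of_isOpen j hU hy).symm
  set A : Set E3 := {y | 16 ≤ ‖y‖} ∩ {y | ‖y‖ ≤ 128} with hA_def
  have hAc : IsClosed A :=
    (isClosed_le continuous_const continuous_norm).inter (isClosed_le continuous_norm continuous_const)
  have hA : IsCompact A :=
    (isCompact_closedBall (0 : E3) 128).of_isClosed_subset hAc fun y hy ↦ mem_closedBall_zero_iff.2 hy.2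
  have hAU : A ⊆ U := fun y hy ↦ show (1 : ℝ) < ‖y‖ from lt_of_lt_of_le (by norm_num) hy.1
  obtain ⟨C, hC⟩ := hA.exists_bound_of_continuousOn (hc2.mono hAU)
  exact ⟨max C 0, le_max_right _ _, fun x h1 h2 ↦ (hC x ⟨h1, h2⟩).trans (le_max_left _ _)⟩

/-- One absolute bound for `D^j (‖·‖⁻¹)`, `j ≤ 2`, on the annulus `{16 ≤ ‖x‖ ≤ 128}`. [folklore] -/
theorem srd_exists_bound_invNorm :
    ∃ B : ℝ, 0 ≤ B ∧ ∀ j ≤ 2, ∀ x : E3, 16 ≤ ‖x‖ → ‖x‖ ≤ 128 →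
      ‖iteratedFDeriv ℝ j (fun y : E3 ↦ ‖y‖⁻¹) x‖ ≤ B := by
  obtain ⟨B0, h0, hB0⟩ := srd_exists_bound_invNorm_j 0
  obtain ⟨B1, h1, hB1⟩ := srd_exists_bound_invNorm_j 1
  obtain ⟨B2, h2, hB2⟩ := srd_exists_bound_invNorm_j 2
  refine ⟨B0 + B1 + B2, by positivity, fun j hj x hx1 hx2 ↦ ?_⟩
  interval_cases j <;> linarith [hB0 x hx1 hx2, hB1 x hx1 hx2, hB2 x hx1 hx2]

/-! ## §2 The scaled variation `ŵ(ẑ) = w(c + s ẑ)/b`, `s = b⁻²` -/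

/-- The pull-back `ẑ ↦ c + b⁻² ẑ` maps the ball `‖ẑ‖ < 256` into the site ball `B(c, 256/b²)`. [folklore] -/
theorem srd_site_mem_ball {b : ℝ} (hb : 0 < b) (c x : E3) (hx : ‖x‖ < 256) :
    c + (b ^ 2)⁻¹ • x ∈ Metric.ball c (256 / b ^ 2) := by
  have hs : 0 < (b ^ 2)⁻¹ := inv_pos.2 (pow_pos hb 2)
  rw [Metric.mem_ball, dist_eq_norm, add_sub_cancel_left, norm_smul, Real.norm_of_nonneg hs.le]
  calc (b ^ 2)⁻¹ * ‖x‖ < (b ^ 2)⁻¹ * 256 := mul_lt_mul_of_pos_left hx hs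
    _ = 256 / b ^ 2 := by rw [div_eq_mul_inv, mul_comm]

/-- The scaled variation `ŵ(ẑ) = w(c + b⁻² ẑ)/b` is smooth at every `‖ẑ‖ < 256` when `w` is smooth on the
site ball. [folklore] -/
theorem srd_contDiffAt_siteVar {b : ℝ} {c : E3} {w : E3 → ℝ} (hb : 0 < b)
    (hw : ContDiffOn ℝ ∞ w (Metric.ball c (256 / b ^ 2))) {x : E3} (hx : ‖x‖ < 256) :
    ContDiffAt ℝ ∞ (fun z : E3 ↦ b⁻¹ * w (c + (b ^ 2)⁻¹ • z)) x := by
  have h1 : ContDiffAt ℝ ∞ w (c + (b ^ 2)⁻¹ • x) :=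
    hw.contDiffAt (Metric.isOpen_ball.mem_nhds (srd_site_mem_ball hb c x hx))
  exact contDiffAt_const.mul (h1.comp x (contDiffAt_const.add (contDiffAt_id.const_smul _)))

/-- **First and second derivatives of the scaled variation**: `‖D^j ŵ(ẑ)‖ ≤ W` for `j = 1, 2` and
`‖ẑ‖ < 256` (chain rule under `ẑ ↦ c + s ẑ`: a factor `s^j`, and `b⁻¹ s^j b^{2j+1} = 1`). [folklore] -/
theorem srd_norm_iteratedFDeriv_siteVar_le {b W : ℝ} {c : E3} {w : E3 → ℝ} (hb : 0 < b)
    (hw : ContDiffOn ℝ ∞ w (Metric.ball c (256 / b ^ 2)))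
    (hwb : ∀ m : ℕ, 1 ≤ m → m ≤ 2 → ∀ y ∈ Metric.ball c (256 / b ^ 2),
      ‖iteratedFDeriv ℝ m w y‖ ≤ W * b ^ (2 * m + 1))
    {j : ℕ} (hj1 : 1 ≤ j) (hj2 : j ≤ 2) {z : E3} (hz : ‖z‖ < 256) :
    ‖iteratedFDeriv ℝ j (fun x : E3 ↦ b⁻¹ * w (c + (b ^ 2)⁻¹ • x)) z‖ ≤ W := by
  have hs : 0 < (b ^ 2)⁻¹ := inv_pos.2 (pow_pos hb 2)
  have hcomp : ContDiffAt ℝ ∞ (fun x : E3 ↦ w (c + (b ^ 2)⁻¹ • x)) z :=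
    (hw.contDiffAt (Metric.isOpen_ball.mem_nhds (srd_site_mem_ball hb c z hz))).comp z
      (contDiffAt_const.add (contDiffAt_id.const_smul _))
  have e1 : (fun x : E3 ↦ b⁻¹ * w (c + (b ^ 2)⁻¹ • x)) = b⁻¹ • (fun x : E3 ↦ w (c + (b ^ 2)⁻¹ • x)) := by
    funext x
    simp
  rw [e1, iteratedFDeriv_const_smul_apply (hcomp.of_le (by exact_mod_cast le_top)), norm_smul,
    Real.norm_of_nonneg (inv_pos.2 hb).le]
  -- scaling, then translation, then the hypothesis at `y = c + s z`
  have h2 := norm_iteratedFDeriv_comp_smul_le (fun y : E3 ↦ w (c + y)) hs j z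
  have h3 : iteratedFDeriv ℝ j (fun y : E3 ↦ w (c + y)) ((b ^ 2)⁻¹ • z) =
      iteratedFDeriv ℝ j w (c + (b ^ 2)⁻¹ • z) := iteratedFDeriv_comp_add_left j c _
  rw [h3] at h2
  have h4 := hwb j hj1 hj2 _ (srd_site_mem_ball hb c z hz)
  have hb0 : b ≠ 0 := hb.ne'
  calc b⁻¹ * ‖iteratedFDeriv ℝ j (fun x : E3 ↦ w (c + (b ^ 2)⁻¹ • x)) z‖
      ≤ b⁻¹ * (((b ^ 2)⁻¹) ^ j * (W * b ^ (2 * j + 1))) :=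
        mul_le_mul_of_nonneg_left (h2.trans (mul_le_mul_of_nonneg_left h4 (pow_nonneg hs.le _)))
          (inv_pos.2 hb).le
    _ = W := by
        interval_cases j <;> (field_simp; ring)

/-- **Size of the scaled variation**: `|ŵ(ẑ)| ≤ 128 W` for `‖ẑ‖ ≤ 128` (mean value inequality on the ball
`‖ẑ‖ < 256` from `ŵ(0) = w(c)/b = 0` and `‖D ŵ‖ ≤ W`). [folklore] -/
theorem srd_norm_siteVar_le {b W : ℝ} {c : E3} {w : E3 → ℝ} (hb : 0 < b) (hW : 0 ≤ W)
    (hw : ContDiffOn ℝ ∞ w (Metric.ball c (256 / b ^ 2))) (hwc : w c = 0)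
    (hwb : ∀ m : ℕ, 1 ≤ m → m ≤ 2 → ∀ y ∈ Metric.ball c (256 / b ^ 2),
      ‖iteratedFDeriv ℝ m w y‖ ≤ W * b ^ (2 * m + 1))
    {z : E3} (hz : ‖z‖ ≤ 128) :
    ‖b⁻¹ * w (c + (b ^ 2)⁻¹ • z)‖ ≤ 128 * W := by
  set F : E3 → ℝ := fun x ↦ b⁻¹ * w (c + (b ^ 2)⁻¹ • x) with hF
  have hdiff : ∀ x ∈ Metric.ball (0 : E3) 256, DifferentiableAt ℝ F x := fun x hx ↦
    (srd_contDiffAt_siteVar hb hw (mem_ball_zero_iff.1 hx)).differentiableAt (by simp)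
  have hbound : ∀ x ∈ Metric.ball (0 : E3) 256, ‖fderiv ℝ F x‖ ≤ W := fun x hx ↦ by
    rw [← norm_iteratedFDeriv_one]
    exact srd_norm_iteratedFDeriv_siteVar_le hb hw hwb le_rfl one_le_two (mem_ball_zero_iff.1 hx)
  have hz' : z ∈ Metric.ball (0 : E3) 256 := mem_ball_zero_iff.2 (by linarith)
  have h0 : (0 : E3) ∈ Metric.ball (0 : E3) 256 := Metric.mem_ball_self (by norm_num)
  have key := (convex_ball (0 : E3) 256).norm_image_sub_le_of_norm_fderiv_le hdiff hbound h0 hz'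
  have hF0 : F 0 = 0 := by simp [hF, hwc]
  rw [hF0, sub_zero, sub_zero] at key
  calc ‖F z‖ ≤ W * ‖z‖ := key
    _ ≤ W * 128 := mul_le_mul_of_nonneg_left hz hW
    _ = 128 * W := mul_comm _ _

/-! ## §3 The identity on the punctured ball and the assembly -/

/-- The scalar identity behind `s² ψ(c + s ẑ)⁴ − (1 + 2αb/(2‖ẑ‖))⁴ = ŵ (2u + ŵ)((u + ŵ)² + u²)`,
`u = 1 + αb/r`, `ŵ = w′/b`, `s = b⁻²`, `r = ‖ẑ‖`. [folklore] -/
theorem srd_scalar_identity {b α r w' : ℝ} (hb : b ≠ 0) (hr : r ≠ 0) :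
    ((b ^ 2)⁻¹) ^ 2 * (b + α / ((b ^ 2)⁻¹ * r) + w') ^ 4 - (1 + 2 * α * b / (2 * r)) ^ 4 =
      b⁻¹ * w' * ((1 + α * b * r⁻¹) + (1 + α * b * r⁻¹) + b⁻¹ * w') *
        (((1 + α * b * r⁻¹) + b⁻¹ * w') * ((1 + α * b * r⁻¹) + b⁻¹ * w') +
          (1 + α * b * r⁻¹) * (1 + α * b * r⁻¹)) := by
  field_simp
  ring

/-- **Toolkit T3 (site reading deviation)** of `stub_bulkAt`: at a puncture `c` of a time-symmetric bulk
`B` whose metric near `c` is `(b + α/‖y − c‖ + w y)⁴ • δ` with `w(c) = 0` and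
`‖D^m w‖ ≤ W b^{2m+1}` (`m = 1, 2`) on `B(c, 256/b²)`, the pure pull-back reading at scale `s = b⁻²` has
`k`-part `0` and metric part `C²`-close, on the unit-chart annulus `16 ≤ ‖ẑ‖ ≤ 128`, to the exact
Schwarzschild far field `schwField (2αb)`: `‖D^m(s² h_B(c + s ·) − schwField (2αb))(ẑ)‖ ≤ K W` for
`m ≤ 2`, with one absolute constant `K`. [folklore] -/
theorem stub_siteReadingDev :
    ∃ K : ℝ, 0 < K ∧ ∀ (b α W : ℝ) (c : E3) (w : E3 → ℝ) (B : InitialDataSet (𝓡 3) E3),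
      0 < b → 0 < α → 2 * α * b ≤ 1 → 0 ≤ W → 256 * W ≤ 1 →
      (∀ y : E3, B.k y = 0) →
      ContDiffOn ℝ ∞ w (Metric.ball c (256 / b ^ 2)) → w c = 0 →
      (∀ m : ℕ, 1 ≤ m → m ≤ 2 → ∀ y ∈ Metric.ball c (256 / b ^ 2),
        ‖iteratedFDeriv ℝ m w y‖ ≤ W * b ^ (2 * m + 1)) →
      (∀ y ∈ Metric.ball c (256 / b ^ 2), y ≠ c →
        B.coordH y = (b + α / ‖y - c‖ + w y) ^ 4 • (innerSL ℝ : E3 →L[ℝ] E3 →L[ℝ] ℝ)) →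
      ∀ yh : E3, 16 ≤ ‖yh‖ → ‖yh‖ ≤ 128 →
        ((b ^ 2)⁻¹) ^ 2 • B.coordK (c + (b ^ 2)⁻¹ • yh) = 0 ∧
        ∀ m : ℕ, m ≤ 2 → ‖iteratedFDeriv ℝ m
          (fun z : E3 ↦ ((b ^ 2)⁻¹) ^ 2 • B.coordH (c + (b ^ 2)⁻¹ • z) - schwField (2 * α * b) z) yh‖
            ≤ K * W := by
  obtain ⟨Binv, hBinv0, hBinv⟩ := srd_exists_bound_invNorm
  -- `A` bounds the `C²` size of `u = 1 + αb/‖·‖` on the annulus, uniformly (`αb ≤ 1/2`)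
  set A : ℝ := 1 + 2 * Binv with hA_def
  have hA1 : 1 ≤ A := by rw [hA_def]; linarith
  refine ⟨122880 * A ^ 3, by positivity, ?_⟩
  intro b α W c w B hb hα hαb hW0 hW256 hk hw hwc hwb hH yh hyh1 hyh2
  have hs : 0 < (b ^ 2)⁻¹ := inv_pos.2 (pow_pos hb 2)
  have hαb : α * b ≤ 1 / 2 := by linarith
  have hαb0 : 0 ≤ α * b := by positivity
  refine ⟨?_, ?_⟩
  · -- the `k`-part: `B.k = 0`
    have hK0 : B.coordK (c + (b ^ 2)⁻¹ • yh) = 0 := by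
      ext v v'
      simp [hk]
    rw [hK0, smul_zero]
  intro m hm
  -- the open punctured ball, a neighbourhood of the annulus
  set U : Set E3 := {z : E3 | 0 < ‖z‖} ∩ Metric.ball 0 256 with hU_def
  have hU : IsOpen U := (isOpen_lt continuous_const continuous_norm).inter Metric.isOpen_ball
  have hyU : yh ∈ U := ⟨show (0 : ℝ) < ‖yh‖ by linarith, mem_ball_zero_iff.2 (by linarith)⟩
  -- the two scalar functions
  obtain ⟨u, hu_def⟩ : ∃ u : E3 → ℝ, u = fun z ↦ 1 + α * b * ‖z‖⁻¹ := ⟨_, rfl⟩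
  obtain ⟨wh, hwh_def⟩ : ∃ wh : E3 → ℝ, wh = fun z ↦ b⁻¹ * w (c + (b ^ 2)⁻¹ • z) := ⟨_, rfl⟩
  obtain ⟨φ, hφ_def⟩ : ∃ φ : E3 → ℝ,
      φ = fun z ↦ wh z * (u z + u z + wh z) * ((u z + wh z) * (u z + wh z) + u z * u z) := ⟨_, rfl⟩
  -- smoothness on `U`
  have hinvU : ContDiffOn ℝ ∞ (fun z : E3 ↦ ‖z‖⁻¹) U := fun z hz ↦ by
    have hz0 : z ≠ 0 := norm_pos_iff.1 hz.1
    exact ((contDiffAt_norm ℝ hz0).inv (norm_ne_zero_iff.2 hz0)).contDiffWithinAt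
  have huU : ContDiffOn ℝ ∞ u U := by
    rw [hu_def]
    exact contDiffOn_const.add (contDiffOn_const.mul hinvU)
  have hwhU : ContDiffOn ℝ ∞ wh U := by
    rw [hwh_def]
    exact fun z hz ↦ (srd_contDiffAt_siteVar hb hw (mem_ball_zero_iff.1 hz.2)).contDiffWithinAt
  have hφU : ContDiffOn ℝ ∞ φ U := by
    rw [hφ_def]
    exact (hwhU.mul ((huU.add huU).add hwhU)).mul (((huU.add hwhU).mul (huU.add hwhU)).add (huU.mul huU))
  -- `C²` sizes at `yh`: `u ≤ A`, `ŵ ≤ 128 W`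
  have hub : ∀ j ≤ 2, ‖iteratedFDeriv ℝ j u yh‖ ≤ A := by
    have h1 : ∀ j ≤ 2, ‖iteratedFDeriv ℝ j (fun z : E3 ↦ α * b * ‖z‖⁻¹) yh‖ ≤ 4 * |α * b| * Binv :=
      srd_c2_mul hU hyU contDiffOn_const hinvU (srd_c2_const (α * b) yh)
        (fun j hj ↦ hBinv j hj yh hyh1 hyh2)
    have h2 : ∀ j ≤ 2, ‖iteratedFDeriv ℝ j (fun z : E3 ↦ 1 + α * b * ‖z‖⁻¹) yh‖ ≤
        |(1 : ℝ)| + 4 * |α * b| * Binv :=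
      srd_c2_add hU hyU contDiffOn_const (contDiffOn_const.mul hinvU) (srd_c2_const 1 yh) h1
    intro j hj
    rw [hu_def]
    refine (h2 j hj).trans ?_
    rw [abs_one, abs_of_nonneg hαb0, hA_def]
    nlinarith
  have hwhb : ∀ j ≤ 2, ‖iteratedFDeriv ℝ j wh yh‖ ≤ 128 * W := by
    intro j hj
    rw [hwh_def]
    rcases Nat.eq_zero_or_pos j with rfl | hj0
    · rw [norm_iteratedFDeriv_zero]
      exact srd_norm_siteVar_le hb hW0 hw hwc hwb hyh2
    · exact (srd_norm_iteratedFDeriv_siteVar_le hb hw hwb hj0 hj (by linarith)).trans (by linarith)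
  -- `C²` size of `φ = ŵ (2u + ŵ)((u + ŵ)² + u²)` at `yh`
  have e2 : ∀ j ≤ 2, ‖iteratedFDeriv ℝ j (fun z ↦ u z + u z + wh z) yh‖ ≤ A + A + 128 * W :=
    srd_c2_add hU hyU (huU.add huU) hwhU (srd_c2_add hU hyU huU huU hub hub) hwhb
  have e3 : ∀ j ≤ 2, ‖iteratedFDeriv ℝ j (fun z ↦ u z + wh z) yh‖ ≤ A + 128 * W :=
    srd_c2_add hU hyU huU hwhU hub hwhb
  have e6 : ∀ j ≤ 2, ‖iteratedFDeriv ℝ j (fun z ↦ (u z + wh z) * (u z + wh z) + u z * u z) yh‖ ≤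
      4 * (A + 128 * W) * (A + 128 * W) + 4 * A * A :=
    srd_c2_add hU hyU ((huU.add hwhU).mul (huU.add hwhU)) (huU.mul huU)
      (srd_c2_mul hU hyU (huU.add hwhU) (huU.add hwhU) e3 e3) (srd_c2_mul hU hyU huU huU hub hub)
  have e7 : ∀ j ≤ 2, ‖iteratedFDeriv ℝ j (fun z ↦ wh z * (u z + u z + wh z)) yh‖ ≤
      4 * (128 * W) * (A + A + 128 * W) :=
    srd_c2_mul hU hyU hwhU ((huU.add huU).add hwhU) hwhb e2
  have hφb : ∀ j ≤ 2, ‖iteratedFDeriv ℝ j φ yh‖ ≤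
      4 * (4 * (128 * W) * (A + A + 128 * W)) * (4 * (A + 128 * W) * (A + 128 * W) + 4 * A * A) := by
    rw [hφ_def]
    exact srd_c2_mul hU hyU (hwhU.mul ((huU.add huU).add hwhU))
      (((huU.add hwhU).mul (huU.add hwhU)).add (huU.mul huU)) e7 e6
  -- the identity on `U`
  have hG : ∀ z ∈ U, ((b ^ 2)⁻¹) ^ 2 • B.coordH (c + (b ^ 2)⁻¹ • z) - schwField (2 * α * b) z =
      φ z • (innerSL ℝ : E3 →L[ℝ] E3 →L[ℝ] ℝ) := by
    intro z hz
    have hz0 : 0 < ‖z‖ := hz.1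
    have hzne : z ≠ 0 := norm_pos_iff.1 hz0
    have hne : c + (b ^ 2)⁻¹ • z ≠ c := by
      rw [ne_eq, add_eq_left]
      exact smul_ne_zero hs.ne' hzne
    rw [hH (c + (b ^ 2)⁻¹ • z) (srd_site_mem_ball hb c z (mem_ball_zero_iff.1 hz.2)) hne, smul_smul,
      schwField, ← sub_smul]
    congr 1
    rw [add_sub_cancel_left, norm_smul, Real.norm_of_nonneg hs.le, hφ_def, hu_def, hwh_def]
    exact srd_scalar_identity hb.ne' hz0.ne'
  have hGev : (fun z : E3 ↦ ((b ^ 2)⁻¹) ^ 2 • B.coordH (c + (b ^ 2)⁻¹ • z) - schwField (2 * α * b) z)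
      =ᶠ[𝓝 yh] fun z ↦ φ z • (innerSL ℝ : E3 →L[ℝ] E3 →L[ℝ] ℝ) := by
    filter_upwards [hU.mem_nhds hyU] with z hz
    exact hG z hz
  -- peel the constant form `δ = innerSL`
  set L : ℝ →L[ℝ] (E3 →L[ℝ] E3 →L[ℝ] ℝ) :=
    (ContinuousLinearMap.id ℝ ℝ).smulRight (innerSL ℝ : E3 →L[ℝ] E3 →L[ℝ] ℝ) with hL_def
  have hL1 : ‖L‖ ≤ 1 := by
    rw [hL_def, ContinuousLinearMap.norm_smulRight_apply]
    calc ‖ContinuousLinearMap.id ℝ ℝ‖ * ‖(innerSL ℝ : E3 →L[ℝ] E3 →L[ℝ] ℝ)‖ ≤ 1 * 1 :=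
          mul_le_mul ContinuousLinearMap.norm_id_le (norm_innerSL_le ℝ) (norm_nonneg _) zero_le_one
      _ = 1 := one_mul 1
  have hLφ : (fun z ↦ φ z • (innerSL ℝ : E3 →L[ℝ] E3 →L[ℝ] ℝ)) = L ∘ φ := rfl
  have hφx : ContDiffAt ℝ ∞ φ yh := hφU.contDiffAt (hU.mem_nhds hyU)
  have hε0 : 0 ≤ 128 * W := by positivity
  have hεA : 128 * W ≤ A := by linarith
  have f1 : A + A + 128 * W ≤ 3 * A := by linarith
  have f2 : 4 * (A + 128 * W) * (A + 128 * W) + 4 * A * A ≤ 20 * A ^ 2 := by nlinarith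
  calc ‖iteratedFDeriv ℝ m
          (fun z : E3 ↦ ((b ^ 2)⁻¹) ^ 2 • B.coordH (c + (b ^ 2)⁻¹ • z) - schwField (2 * α * b) z) yh‖
      = ‖iteratedFDeriv ℝ m (L ∘ φ) yh‖ := by rw [(hGev.iteratedFDeriv ℝ m).eq_of_nhds, hLφ]
    _ ≤ ‖L‖ * ‖iteratedFDeriv ℝ m φ yh‖ := L.norm_iteratedFDeriv_comp_left hφx (by exact_mod_cast le_top)
    _ ≤ 1 * (4 * (4 * (128 * W) * (A + A + 128 * W)) * (4 * (A + 128 * W) * (A + 128 * W) + 4 * A * A)) :=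
        mul_le_mul hL1 (hφb m hm) (norm_nonneg _) zero_le_one
    _ = 16 * (128 * W) * ((A + A + 128 * W) * (4 * (A + 128 * W) * (A + 128 * W) + 4 * A * A)) := by
        ring
    _ ≤ 16 * (128 * W) * ((3 * A) * (20 * A ^ 2)) :=
        mul_le_mul_of_nonneg_left (mul_le_mul f1 f2 (by positivity) (by positivity)) (by positivity)
    _ = 122880 * A ^ 3 * W := by ring

end Summit.FinalStateConjecture.FinalStateConjecture.Theorems.SwallowTheDatum.UniversalWitnessFamily

end
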